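import Mathlib.Analysis.SpecialFunctions.Trigonometric.Deriv
import Mathlib.Analysis.SpecialFunctions.Trigonometric.Bounds
import Mathlib.Analysis.Real.Pi.Bounds
import Literature.Topology.FourManifolds.PlanarArch
import HarnessLib

/-!
# The unknot is a unit for the connected sum — polar/inversion model, I: the inverted polar point

Topic `Literature/Topology/FourManifolds`. Seat-B infrastructure for the discharge of the named fact
`Literature.Topology.FourManifolds.Knot.exists_isConnectedSum_unknot_isIsotopic` (`BandSum.lean`;
Rolfsen, *Knots and Links* (1976), §2.G: `K # O ≅ K` for the unknot `O`). The band of the connected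
sum `K # O` used in this line is the image, under the inversion `ι` of the plane with centre `10 i`
and power `200`, of a polar rectangle `{r e^{iθ} : 1 ≤ r ≤ 10, θ ∈ window}`: the circle `r = 10`
passes through the centre of `ι`, so its image is the real line (which carries the flat arc of the
knot), the unit circle `r = 1` becomes a round circle `O_c` below the line (the unknot), the
concentric circle `r = 11/2` becomes the round circle in which a round splitting 2-sphere meets the
plane, and injectivity, regularity and the crossing condition of the band are read off from polar
coordinates. This file is the pure real analysis of the two coordinates of the inverted polar point,

* `U r θ = 200 r cos θ / Q`, `W r θ = 10 + 200 (r sin θ - 10)/Q = 10 (r² - 100)/Q`,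
  `Q r θ = r² - 20 r sin θ + 100 = |r e^{iθ} - 10 i|²`,

with `Q` replaced by a **smooth floor** `sfl Q` (`sfl q = q` for `q ≥ 10`, `sfl ≥ 5` everywhere) so
that `U`, `W` are globally `C^∞`; on the region `Q ≥ 10`, which contains everything the construction
uses, nothing changes (`U_eq`, `W_eq`). Proved here, all elementary:

* the line, the circles and the sphere: `W = 0 ↔ r = 10` (`W_eq_zero_iff`, with the sign lemmas
  `W_neg_iff`, `W_pos_iff`), the inversion of circles about the origin (`inversion_identity`:
  `U² + (W - w ρ)² = ρS² + 200² (r² - ρ²)/(Q (100 - ρ²))`), whence the round image `O_c` of the unit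
  circle (`circle_identity`, centre `(0, -1010/99)`, radius `200/99`) and the splitting circle
  (`mem_sphere_iff`, `inside_sphere_iff`: on it iff `r = 11/2`, inside iff `r < 11/2`);
* bounds (`abs_U_le`, `W_le`, `W_ge`) and the sines on the window (`sin_le_half`, …);
* the partial derivatives `Ur`, `Uθ`, `Wr`, `Wθ` with the chain rules along a curve
  (`hasDerivAt_U_comp`, `hasDerivAt_W_comp`), the conformal relations `Uθ = r Wr`, `Wθ = -r Ur`,
  `Ur² + Wr² > 0` (`Ur_sq_add_Wr_sq_pos`), and the **signs** that drive the monotonicity of the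
  excursion of `K # O` in the sequel: `Ur` has the sign of `cos θ` (`Ur_pos`, `Ur_neg`), `Uθ > 0` for
  `21/10 ≤ r ≤ 11`, `sin θ ≤ 2/5` (`Uθ_pos`) and `Uθ < 0` for `r ≤ 17/10`, `sin θ ≥ 339/1000`
  (`Uθ_neg`), `Uθ 10 θ > 0` (`Uθ_ten_pos`);
* recovering the polar point from its image (`mul_cos_eq`, `mul_sin_eq`, `polar_eq_of_eq`,
  `eq_of_polar_eq`): the model is injective on the region.

The band coordinates `(x₀, x₁) ↦ (r, θ) = (1 + 9 x₀, -π - 2/5 + κ (x₁ + 1/10))` and the resulting map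
on `ℝ²` are in `BandSumUnitPolarCoords.lean`.

## References

* D. Rolfsen, *Knots and Links*, Publish or Perish (1976), §2.G (the consumer). [Rolfsen1976]

## Design notes

Everything is `[folklore]`; no named facts, no `sorry`. The numbers (`R = 10`, power `200`, splitting
radius `11/2`, window `(-π - 2/5, 2/5)`) are fixed once and for all; only the final scale of the picture
depends on the knot. The other seat's line (`BandSumUnitChart.lean`, `BandSumUnitProfiles.lean`: a
rectangular band and a D-shaped unknot) is independent of this one.
-/

open scoped ContDiff Topology Real
open Function Set Real

noncomputable section

namespace Literature.Topology.FourManifolds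

namespace BandSumUnit

namespace Polar

/-! ### A smooth floor -/

/-- **Smooth floor at `10`**: `sfl q = q` for `q ≥ 10`, `sfl q = 10` for `q ≤ 5`, always `≥ 5`. [folklore] -/
def sfl (q : ℝ) : ℝ := 10 + smoothStep 5 10 q * (q - 10)

/-- The smooth floor is the identity on `[10, ∞)`. [folklore] -/
theorem sfl_of_ge {q : ℝ} (hq : 10 ≤ q) : sfl q = q := by
  rw [sfl, smoothStep_of_ge (by norm_num) hq]; ring

/-- The smooth floor is the constant `10` on `(-∞, 5]`. [folklore] -/
theorem sfl_of_le {q : ℝ} (hq : q ≤ 5) : sfl q = 10 := by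
  rw [sfl, smoothStep_of_le (by norm_num) hq]; ring

/-- The smooth floor is at least `5`. [folklore] -/
theorem five_le_sfl (q : ℝ) : 5 ≤ sfl q := by
  rw [sfl]
  obtain ⟨h0, h1⟩ := smoothStep_mem_Icc 5 10 q
  by_cases hq : 10 ≤ q
  · rw [smoothStep_of_ge (by norm_num) hq]; linarith
  · by_cases hq' : q ≤ 5
    · rw [smoothStep_of_le (by norm_num) hq']; linarith
    · push Not at hq hq'
      nlinarith

/-- The smooth floor is positive. [folklore] -/
theorem sfl_pos (q : ℝ) : 0 < sfl q := by linarith [five_le_sfl q]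

/-- The smooth floor never vanishes. [folklore] -/
theorem sfl_ne_zero (q : ℝ) : sfl q ≠ 0 := (sfl_pos q).ne'

/-- The smooth floor is `C^∞`. [folklore] -/
theorem contDiff_sfl : ContDiff ℝ ∞ sfl :=
  contDiff_const.add ((contDiff_smoothStep 5 10).mul (contDiff_id.sub contDiff_const))

/-- Near a point `q > 10` the smooth floor is the identity. [folklore] -/
theorem sfl_eventuallyEq {q : ℝ} (hq : 10 < q) : sfl =ᶠ[𝓝 q] id := by
  filter_upwards [Ioi_mem_nhds hq] with y hy using sfl_of_ge (le_of_lt hy)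

/-- The smooth floor has derivative `1` at points `q > 10`. [folklore] -/
theorem hasDerivAt_sfl {q : ℝ} (hq : 10 < q) : HasDerivAt sfl 1 q :=
  (hasDerivAt_id q).congr_of_eventuallyEq (sfl_eventuallyEq hq)

/-! ### The model: inversion of polar points -/

/-- `Q r θ = r² - 20 r sin θ + 100`, the squared distance from the polar point `r e^{iθ}` to the
centre `10 i` of the inversion. [folklore] -/
def Q (r θ : ℝ) : ℝ := r ^ 2 - 20 * r * sin θ + 100

/-- First coordinate of the inverted polar point (inversion centre `10 i`, power `200`). [folklore] -/
def U (r θ : ℝ) : ℝ := 200 * r * cos θ / sfl (Q r θ)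

/-- Second coordinate of the inverted polar point. [folklore] -/
def W (r θ : ℝ) : ℝ := 10 + 200 * (r * sin θ - 10) / sfl (Q r θ)

/-- Unfolding `Q`. [folklore] -/
theorem Q_def (r θ : ℝ) : Q r θ = r ^ 2 - 20 * r * sin θ + 100 := rfl

/-- `Q` as a sum of squares: `(r - 10 sin θ)² + 100 cos² θ`. [folklore] -/
theorem Q_eq (r θ : ℝ) : Q r θ = (r - 10 * sin θ) ^ 2 + 100 * cos θ ^ 2 := by
  rw [Q]; nlinarith [sin_sq_add_cos_sq θ]

/-- `Q` is nonnegative. [folklore] -/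
theorem Q_nonneg (r θ : ℝ) : 0 ≤ Q r θ := by rw [Q_eq]; positivity

/-- `Q ≥ (10 - r)²` for `r ≥ 0`. [folklore] -/
theorem sq_le_Q {r : ℝ} (hr : 0 ≤ r) (θ : ℝ) : (10 - r) ^ 2 ≤ Q r θ := by
  rw [Q]; nlinarith [mul_le_mul_of_nonneg_left (sin_le_one θ) hr]

/-- On the sector `sin θ ≤ 1/2`, `Q ≥ 10 r`. [folklore] -/
theorem Q_ge_of_sin_le {r θ : ℝ} (hr : 0 ≤ r) (hs : sin θ ≤ 1 / 2) : 10 * r ≤ Q r θ := by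
  rw [Q]; nlinarith [sq_nonneg (r - 10), mul_le_mul_of_nonneg_left hs hr]

/-- For `0 ≤ r ≤ 1`, `Q ≥ 81`. [folklore] -/
theorem Q_ge_of_le_one {r θ : ℝ} (hr : 0 ≤ r) (hr1 : r ≤ 1) : 81 ≤ Q r θ := by
  have := sq_le_Q hr θ; nlinarith

/-- For `r ≥ 1` and `sin θ ≤ 1/2`, `Q ≥ 10`. [folklore] -/
theorem ten_le_Q {r θ : ℝ} (hr : 1 ≤ r) (hs : sin θ ≤ 1 / 2) : 10 ≤ Q r θ := by
  have := Q_ge_of_sin_le (r := r) (by linarith) hs; linarith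

/-- For `r > 1` and `sin θ ≤ 1/2`, `Q > 10`. [folklore] -/
theorem ten_lt_Q {r θ : ℝ} (hr : 1 < r) (hs : sin θ ≤ 1 / 2) : 10 < Q r θ := by
  have := Q_ge_of_sin_le (r := r) (by linarith) hs; linarith

/-- On the region `Q ≥ 10` the smooth floor disappears from `U`. [folklore] -/
theorem U_eq {r θ : ℝ} (hQ : 10 ≤ Q r θ) : U r θ = 200 * r * cos θ / Q r θ := by
  rw [U, sfl_of_ge hQ]

/-- On the region `Q ≥ 10`: `W = 10 (r² - 100)/Q`. [folklore] -/
theorem W_eq {r θ : ℝ} (hQ : 10 ≤ Q r θ) : W r θ = 10 * (r ^ 2 - 100) / Q r θ := by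
  have hQ0 : Q r θ ≠ 0 := by linarith
  rw [W, sfl_of_ge hQ]
  rw [eq_div_iff hQ0, add_mul, div_mul_cancel₀ _ hQ0, Q]
  ring

/-- **The right edge lies on the line**: `W = 0 ↔ r = 10` (for `r > 0`, on the region). [folklore] -/
theorem W_eq_zero_iff {r θ : ℝ} (hQ : 10 ≤ Q r θ) (hr : 0 < r) : W r θ = 0 ↔ r = 10 := by
  have hQ0 : Q r θ ≠ 0 := by linarith
  rw [W_eq hQ, div_eq_zero_iff, or_iff_left hQ0]
  constructor
  · intro h
    have : (r - 10) * (r + 10) = 0 := by nlinarith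
    rcases mul_eq_zero.1 this with h | h
    · linarith
    · linarith
  · rintro rfl; norm_num

/-- `W < 0 ↔ r < 10`: the inside of the circle through the centre goes below the line. [folklore] -/
theorem W_neg_iff {r θ : ℝ} (hQ : 10 ≤ Q r θ) (hr : 0 < r) : W r θ < 0 ↔ r < 10 := by
  have hQ0 : 0 < Q r θ := by linarith
  rw [W_eq hQ, div_lt_iff₀ hQ0, zero_mul]
  constructor
  · intro h; nlinarith
  · intro h; nlinarith

/-- `0 < W ↔ 10 < r`. [folklore] -/
theorem W_pos_iff {r θ : ℝ} (hQ : 10 ≤ Q r θ) (hr : 0 < r) : 0 < W r θ ↔ 10 < r := by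
  have hQ0 : 0 < Q r θ := by linarith
  rw [W_eq hQ, lt_div_iff₀ hQ0, zero_mul]
  constructor
  · intro h; nlinarith
  · intro h; nlinarith

/-- `W ≤ 0 ↔ r ≤ 10`. [folklore] -/
theorem W_nonpos_iff {r θ : ℝ} (hQ : 10 ≤ Q r θ) (hr : 0 < r) : W r θ ≤ 0 ↔ r ≤ 10 := by
  rw [← not_lt, W_pos_iff hQ hr, not_lt]

/-- Pure algebra behind the inversion of circles about the origin. [folklore] -/
theorem inversion_aux (r s ρ q m : ℝ) (hq : q = r ^ 2 - 20 * r * s + 100) (hm : m = 100 - ρ ^ 2)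
    (hQ : q ≠ 0) (hρ : m ≠ 0) :
    (200 * r) ^ 2 * (1 - s ^ 2) / q ^ 2 + (10 * (r ^ 2 - 100) / q - 10 * (1 - 200 / m)) ^ 2 =
      (200 * ρ / m) ^ 2 + 200 ^ 2 * (r ^ 2 - ρ ^ 2) / (q * m) := by
  field_simp
  rw [hq, hm]
  ring

/-- **Inversion of circles about the origin.** For the polar point of radius `r` the inverted point
satisfies `U² + (W - w ρ)² = ρS² + 200² (r² - ρ²)/(Q (100 - ρ²))` with
`w ρ = 10 (1 - 200/(100 - ρ²))`, `ρS = 200 ρ/(100 - ρ²)`: the circle `|ζ| = ρ` goes to the circle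
with centre `(0, w ρ)` and radius `ρS`, the inside (`r < ρ < 10`) to the inside. [folklore] -/
theorem inversion_identity {r θ ρ : ℝ} (hQ : 10 ≤ Q r θ) (hρ : 100 - ρ ^ 2 ≠ 0) :
    U r θ ^ 2 + (W r θ - 10 * (1 - 200 / (100 - ρ ^ 2))) ^ 2 =
      (200 * ρ / (100 - ρ ^ 2)) ^ 2 + 200 ^ 2 * (r ^ 2 - ρ ^ 2) / (Q r θ * (100 - ρ ^ 2)) := by
  have hQ0 : Q r θ ≠ 0 := by linarith
  have hU2 : U r θ ^ 2 = (200 * r) ^ 2 * (1 - sin θ ^ 2) / Q r θ ^ 2 := by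
    rw [U_eq hQ, div_pow, ← cos_sq', mul_pow]
  rw [hU2, W_eq hQ]
  exact inversion_aux r (sin θ) ρ (Q r θ) (100 - ρ ^ 2) rfl rfl hQ0 hρ

/-- **The left edge lies on a round circle**: the unit circle inverts onto the circle with centre
`(0, -1010/99)` and radius `200/99`. [folklore] -/
theorem circle_identity (θ : ℝ) : U 1 θ ^ 2 + (W 1 θ + 1010 / 99) ^ 2 = (200 / 99) ^ 2 := by
  have hQ : 10 ≤ Q 1 θ := by have := Q_ge_of_le_one (r := 1) (by norm_num) le_rfl (θ := θ); linarith
  have h := inversion_identity (ρ := 1) hQ (by norm_num)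
  have e1 : (10 : ℝ) * (1 - 200 / (100 - 1 ^ 2)) = -(1010 / 99) := by norm_num
  have e2 : (200 : ℝ) * 1 / (100 - 1 ^ 2) = 200 / 99 := by norm_num
  rw [e1, e2, sub_neg_eq_add] at h
  rw [h]; simp

/-- **Crossing the splitting circle**: with `r_m = 11/2`, the inverted point lies on the circle of
centre `(0, w_S)`, `w_S = 10 (1 - 800/279)`, radius `ρ_S = 4400/279` iff `r = 11/2`; inside iff
`r < 11/2` (for `0 < r`, on the region). [folklore] -/
theorem sphere_identity {r θ : ℝ} (hQ : 10 ≤ Q r θ) :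
    U r θ ^ 2 + (W r θ - 10 * (1 - 800 / 279)) ^ 2 - (4400 / 279) ^ 2 =
      200 ^ 2 * (r ^ 2 - (11 / 2) ^ 2) / (Q r θ * (279 / 4)) := by
  have h := inversion_identity (ρ := 11 / 2) hQ (by norm_num)
  have e1 : (100 : ℝ) - (11 / 2) ^ 2 = 279 / 4 := by norm_num
  rw [e1] at h
  have e2 : (200 : ℝ) / (279 / 4) = 800 / 279 := by norm_num
  have e3 : (200 : ℝ) * (11 / 2) / (279 / 4) = 4400 / 279 := by norm_num
  rw [e2, e3] at h
  linarith

/-- The inverted point lies on the splitting circle iff `r = 11/2`. [folklore] -/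
theorem mem_sphere_iff {r θ : ℝ} (hQ : 10 ≤ Q r θ) (hr : 0 < r) :
    U r θ ^ 2 + (W r θ - 10 * (1 - 800 / 279)) ^ 2 = (4400 / 279) ^ 2 ↔ r = 11 / 2 := by
  have hQ0 : 0 < Q r θ := by linarith
  rw [← sub_eq_zero, sphere_identity hQ, div_eq_zero_iff]
  constructor
  · rintro (h | h)
    · have h' : (r - 11 / 2) * (r + 11 / 2) = 0 := by nlinarith
      rcases mul_eq_zero.1 h' with h'' | h''
      · linarith
      · linarith
    · nlinarith
  · rintro rfl; left; ring

/-- The inverted point lies inside the splitting circle iff `r < 11/2`. [folklore] -/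
theorem inside_sphere_iff {r θ : ℝ} (hQ : 10 ≤ Q r θ) (hr : 0 < r) :
    U r θ ^ 2 + (W r θ - 10 * (1 - 800 / 279)) ^ 2 < (4400 / 279) ^ 2 ↔ r < 11 / 2 := by
  have hQ0 : 0 < Q r θ := by linarith
  rw [← sub_neg, sphere_identity hQ, div_neg_iff]
  constructor
  · rintro (⟨-, h⟩ | ⟨h, -⟩)
    · nlinarith
    · nlinarith
  · intro h; right; exact ⟨by nlinarith, by positivity⟩

/-! ### Bounds -/

/-- `|U| ≤ 20` where `Q ≥ 10 r`, `r > 0`. [folklore] -/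
theorem abs_U_le {r θ : ℝ} (hr : 0 < r) (hQ : 10 ≤ Q r θ) (hQr : 10 * r ≤ Q r θ) : |U r θ| ≤ 20 := by
  have hQ0 : 0 < Q r θ := by linarith
  rw [U_eq hQ, abs_div, abs_of_pos hQ0, div_le_iff₀ hQ0, abs_mul, abs_mul]
  have hc := abs_cos_le_one θ
  rw [abs_of_pos (by norm_num : (0:ℝ) < 200), abs_of_pos hr]
  nlinarith [mul_le_mul_of_nonneg_left hc hr.le]

/-- `W ≤ 21/10` for `10 ≤ r ≤ 11` where `Q ≥ 10 r`. [folklore] -/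
theorem W_le {r θ : ℝ} (hr : 10 ≤ r) (hr' : r ≤ 11) (hQ : 10 ≤ Q r θ) (hQr : 10 * r ≤ Q r θ) :
    W r θ ≤ 21 / 10 := by
  have hQ0 : 0 < Q r θ := by linarith
  rw [W_eq hQ, div_le_iff₀ hQ0]
  nlinarith

/-- A crude lower bound: `-100 ≤ W` on the region `Q ≥ 10`. [folklore] -/
theorem W_ge {r θ : ℝ} (hQ : 10 ≤ Q r θ) : -100 ≤ W r θ := by
  have hQ0 : 0 < Q r θ := by linarith
  rw [W_eq hQ, le_div_iff₀ hQ0]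
  nlinarith [sq_nonneg r]

/-! ### Sines on the window -/

/-- On `[-π - 1/2, 1/2]` the sine is at most `1/2`. [folklore] -/
theorem sin_le_half {θ : ℝ} (h1 : -π - 1 / 2 ≤ θ) (h2 : θ ≤ 1 / 2) : sin θ ≤ 1 / 2 := by
  have hhalf : sin (1 / 2 : ℝ) ≤ 1 / 2 := (sin_lt (by norm_num)).le
  rcases le_or_gt 0 θ with h | h
  · calc sin θ ≤ sin (1 / 2) := sin_le_sin_of_le_of_le_pi_div_two (by linarith [pi_pos])
          (by linarith [pi_gt_three]) h2
      _ ≤ 1 / 2 := hhalf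
  · rcases le_or_gt (-π) θ with h' | h'
    · have := sin_nonpos_of_nonpos_of_neg_pi_le h.le h'
      linarith
    · -- θ = -π - x with x ∈ (0, 1/2]
      have e : sin θ = sin (-π - θ) := by
        rw [show -π - θ = -(θ + π) by ring, sin_neg, sin_add_pi, neg_neg]
      rw [e]
      calc sin (-π - θ) ≤ sin (1 / 2) := sin_le_sin_of_le_of_le_pi_div_two (by linarith [pi_pos])
            (by linarith [pi_gt_three]) (by linarith)
        _ ≤ 1 / 2 := hhalf

/-- `sin (2/5) < 2/5`. [folklore] -/
theorem sin_two_fifths_lt : sin (2 / 5 : ℝ) < 2 / 5 := sin_lt (by norm_num)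

/-- `339/1000 < sin (7/20)`. [folklore] -/
theorem lt_sin_seven_twentieths : (339 / 1000 : ℝ) < sin (7 / 20) := by
  have h := sin_gt_sub_cube (x := (7 / 20 : ℝ)) (by norm_num)
  linarith [show (339 / 1000 : ℝ) < 7 / 20 - (7 / 20) ^ 3 / 6 by norm_num]

/-- `0 < cos θ` for `|θ| < 1`. [folklore] -/
theorem cos_pos_of_abs_lt {θ : ℝ} (h : |θ| < 1) : 0 < cos θ :=
  cos_pos_of_mem_Ioo ⟨by linarith [abs_lt.1 h |>.1, pi_gt_three], by linarith [abs_lt.1 h |>.2, pi_gt_three]⟩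

/-! ### Signs of the partial derivatives -/

/-- The `r`-derivative numerator `cos θ (100 - r²)`. [folklore] -/
def Ur (r θ : ℝ) : ℝ := 200 * cos θ * (100 - r ^ 2) / Q r θ ^ 2

/-- The `θ`-derivative of `U`: `200 r (20 r - (r² + 100) sin θ)/Q²`. [folklore] -/
def Uθ (r θ : ℝ) : ℝ := 200 * r * (20 * r - (r ^ 2 + 100) * sin θ) / Q r θ ^ 2

/-- The numerator of `Uθ` is positive for `21/10 ≤ r ≤ 11`, `sin θ ≤ 2/5`. [folklore] -/
theorem Uθ_num_pos {r θ : ℝ} (hr : 21 / 10 ≤ r) (hr' : r ≤ 11) (hs : sin θ ≤ 2 / 5) :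
    0 < 20 * r - (r ^ 2 + 100) * sin θ := by nlinarith

/-- The numerator of `Uθ` is negative for `r ≤ 17/10`, `sin θ ≥ 339/1000`. [folklore] -/
theorem Uθ_num_neg {r θ : ℝ} (hr' : r ≤ 17 / 10) (hs : 339 / 1000 ≤ sin θ) :
    20 * r - (r ^ 2 + 100) * sin θ < 0 := by nlinarith [sq_nonneg r]

/-- `Uθ > 0` near the outer circle (`21/10 ≤ r ≤ 11`, `sin θ ≤ 2/5`). [folklore] -/
theorem Uθ_pos {r θ : ℝ} (hr : 21 / 10 ≤ r) (hr' : r ≤ 11) (hs : sin θ ≤ 2 / 5) (hQ : 10 ≤ Q r θ) :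
    0 < Uθ r θ := by
  rw [Uθ]
  have := Uθ_num_pos hr hr' hs
  have hQ0 : 0 < Q r θ := by linarith
  positivity

/-- `Uθ < 0` near the unit circle (`0 < r ≤ 17/10`, `sin θ ≥ 339/1000`). [folklore] -/
theorem Uθ_neg {r θ : ℝ} (hr : 0 < r) (hr' : r ≤ 17 / 10) (hs : 339 / 1000 ≤ sin θ) (hQ : 10 ≤ Q r θ) :
    Uθ r θ < 0 := by
  rw [Uθ]
  have := Uθ_num_neg hr' hs
  have hQ0 : 0 < Q r θ := by linarith
  apply div_neg_of_neg_of_pos _ (by positivity)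
  nlinarith

/-- `Ur > 0` where `cos θ > 0` and `r < 10`. [folklore] -/
theorem Ur_pos {r θ : ℝ} (hc : 0 < cos θ) (hr : 0 ≤ r) (hr' : r < 10) (hQ : 10 ≤ Q r θ) : 0 < Ur r θ := by
  rw [Ur]
  have hQ0 : 0 < Q r θ := by linarith
  have : 0 < 100 - r ^ 2 := by nlinarith [mul_nonneg hr hr]
  positivity

/-- `Ur ≥ 0` where `cos θ ≥ 0` and `r ≤ 10`. [folklore] -/
theorem Ur_nonneg {r θ : ℝ} (hc : 0 ≤ cos θ) (hr : 0 ≤ r) (hr' : r ≤ 10) : 0 ≤ Ur r θ := by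
  rw [Ur]
  have : 0 ≤ 100 - r ^ 2 := by nlinarith
  positivity

/-- `Ur < 0` where `cos θ < 0` and `r < 10`. [folklore] -/
theorem Ur_neg {r θ : ℝ} (hc : cos θ < 0) (hr : 0 ≤ r) (hr' : r < 10) (hQ : 10 ≤ Q r θ) : Ur r θ < 0 := by
  rw [Ur]
  have hQ0 : 0 < Q r θ := by linarith
  have : 0 < 100 - r ^ 2 := by nlinarith
  apply div_neg_of_neg_of_pos _ (by positivity)
  nlinarith

/-- `Ur ≤ 0` where `cos θ ≤ 0` and `r ≤ 10`. [folklore] -/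
theorem Ur_nonpos {r θ : ℝ} (hc : cos θ ≤ 0) (hr : 0 ≤ r) (hr' : r ≤ 10) : Ur r θ ≤ 0 := by
  rw [Ur]
  have : 0 ≤ 100 - r ^ 2 := by nlinarith
  apply div_nonpos_of_nonpos_of_nonneg _ (by positivity)
  nlinarith

/-! ### The derivative of `U` along a curve -/

/-- Pure algebra behind the chain rule for `U`. [folklore] -/
theorem deriv_aux (c s r r' θ' q : ℝ) (hq : q = r ^ 2 - 20 * r * s + 100) (hcs : s ^ 2 + c ^ 2 = 1)
    (hq0 : q ≠ 0) :
    (200 * (r' * c + r * (-s * θ')) * q - 200 * r * c * (2 * r * r' - 20 * (r' * s + r * (c * θ')))) / q ^ 2 =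
      200 * c * (100 - r ^ 2) / q ^ 2 * r' + 200 * r * (20 * r - (r ^ 2 + 100) * s) / q ^ 2 * θ' := by
  rw [div_mul_eq_mul_div, div_mul_eq_mul_div, ← add_div,
    div_eq_div_iff (pow_ne_zero 2 hq0) (pow_ne_zero 2 hq0), hq]
  linear_combination (4000 * r ^ 2 * θ') * (r ^ 2 - 20 * r * s + 100) ^ 2 * hcs

/-- Chain rule for `Q` along a curve. [folklore] -/
theorem hasDerivAt_Q_comp {r θ : ℝ → ℝ} {r' θ' t : ℝ} (hr : HasDerivAt r r' t) (hθ : HasDerivAt θ θ' t) :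
    HasDerivAt (fun τ ↦ Q (r τ) (θ τ)) (2 * r t * r' - 20 * (r' * sin (θ t) + r t * (cos (θ t) * θ'))) t := by
  unfold Q
  have hs : HasDerivAt (fun τ ↦ sin (θ τ)) (cos (θ t) * θ') t := (hasDerivAt_sin (θ t)).comp t hθ
  have h1 : HasDerivAt (fun τ ↦ r τ ^ 2) (2 * r t * r') t := by
    simpa using hr.fun_pow 2
  have h2 : HasDerivAt (fun τ ↦ 20 * r τ * sin (θ τ)) (20 * (r' * sin (θ t) + r t * (cos (θ t) * θ'))) t := by
    have := (hr.fun_mul hs).const_mul 20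
    simpa [mul_assoc] using this
  exact (h1.sub h2).add_const 100

/-- **Chain rule for `U` along a curve** `t ↦ (r t, θ t)` through the region `Q > 10`:
`(U ∘ (r, θ))' = Ur · r' + Uθ · θ'`. [folklore] -/
theorem hasDerivAt_U_comp {r θ : ℝ → ℝ} {r' θ' t : ℝ} (hQ : 10 < Q (r t) (θ t))
    (hr : HasDerivAt r r' t) (hθ : HasDerivAt θ θ' t) :
    HasDerivAt (fun τ ↦ U (r τ) (θ τ)) (Ur (r t) (θ t) * r' + Uθ (r t) (θ t) * θ') t := by
  have hQd := hasDerivAt_Q_comp hr hθ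
  have hS : HasDerivAt (fun τ ↦ sfl (Q (r τ) (θ τ)))
      (2 * r t * r' - 20 * (r' * sin (θ t) + r t * (cos (θ t) * θ'))) t := by
    have h := (hasDerivAt_sfl hQ).comp t hQd
    rw [one_mul] at h
    exact h
  have hc : HasDerivAt (fun τ ↦ cos (θ τ)) (-sin (θ t) * θ') t := (hasDerivAt_cos (θ t)).comp t hθ
  have hN : HasDerivAt (fun τ ↦ 200 * r τ * cos (θ τ))
      (200 * (r' * cos (θ t) + r t * (-sin (θ t) * θ'))) t := by
    have := (hr.fun_mul hc).const_mul 200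
    simpa [mul_assoc] using this
  have hD := hN.fun_div hS (sfl_ne_zero _)
  have hsfl : sfl (Q (r t) (θ t)) = Q (r t) (θ t) := sfl_of_ge hQ.le
  refine hD.congr_deriv ?_
  rw [hsfl, Ur, Uθ]
  have hQ0 : Q (r t) (θ t) ≠ 0 := by linarith
  exact deriv_aux (cos (θ t)) (sin (θ t)) (r t) r' θ' (Q (r t) (θ t)) rfl (sin_sq_add_cos_sq (θ t)) hQ0

/-- Chain rule for `U` along the circle `r = 10` (the edge on the line). [folklore] -/
theorem hasDerivAt_U_ten {θ : ℝ → ℝ} {θ' t : ℝ} (hs : sin (θ t) ≤ 1 / 2) (hθ : HasDerivAt θ θ' t) :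
    HasDerivAt (fun τ ↦ U 10 (θ τ)) (Uθ 10 (θ t) * θ') t := by
  have hQ : 10 < Q 10 (θ t) := ten_lt_Q (by norm_num) hs
  have h := hasDerivAt_U_comp (r := fun _ ↦ 10) hQ (hasDerivAt_const t 10) hθ
  simpa using h

/-- On the circle `r = 10` (the line), `Uθ > 0` wherever `sin θ ≤ 1/2`. [folklore] -/
theorem Uθ_ten_pos {θ : ℝ} (hs : sin θ ≤ 1 / 2) : 0 < Uθ 10 θ := by
  rw [Uθ]
  have hQ : 10 < Q 10 θ := ten_lt_Q (by norm_num) hs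
  have : 0 < 20 * (10:ℝ) - (10 ^ 2 + 100) * sin θ := by nlinarith
  positivity

/-! ### The derivative of `W` along a curve -/

/-- The `r`-derivative of `W`: `200 (20 r - (r² + 100) sin θ)/Q²`. [folklore] -/
def Wr (r θ : ℝ) : ℝ := 200 * (20 * r - (r ^ 2 + 100) * sin θ) / Q r θ ^ 2

/-- The `θ`-derivative of `W`: `200 r cos θ (r² - 100)/Q²`. [folklore] -/
def Wθ (r θ : ℝ) : ℝ := 200 * r * cos θ * (r ^ 2 - 100) / Q r θ ^ 2

/-- The conformal structure of the inversion in polar form: `Uθ = r Wr`. [folklore] -/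
theorem Uθ_eq_mul_Wr (r θ : ℝ) : Uθ r θ = r * Wr r θ := by
  rw [Uθ, Wr]; ring

/-- The conformal structure of the inversion in polar form: `Wθ = -r Ur`. [folklore] -/
theorem Wθ_eq_neg_mul_Ur (r θ : ℝ) : Wθ r θ = -(r * Ur r θ) := by
  rw [Wθ, Ur]; ring

/-- Pure algebra behind the chain rule for `W`. [folklore] -/
theorem derivW_aux (c s r r' θ' q : ℝ) (hq : q = r ^ 2 - 20 * r * s + 100) (hq0 : q ≠ 0) :
    (200 * (r' * s + r * (c * θ')) * q - 200 * (r * s - 10) * (2 * r * r' - 20 * (r' * s + r * (c * θ')))) / q ^ 2 =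
      200 * (20 * r - (r ^ 2 + 100) * s) / q ^ 2 * r' + 200 * r * c * (r ^ 2 - 100) / q ^ 2 * θ' := by
  rw [div_mul_eq_mul_div, div_mul_eq_mul_div, ← add_div,
    div_eq_div_iff (pow_ne_zero 2 hq0) (pow_ne_zero 2 hq0), hq]
  ring

/-- **Chain rule for `W` along a curve** through the region `Q > 10`:
`(W ∘ (r, θ))' = Wr · r' + Wθ · θ'`. [folklore] -/
theorem hasDerivAt_W_comp {r θ : ℝ → ℝ} {r' θ' t : ℝ} (hQ : 10 < Q (r t) (θ t))
    (hr : HasDerivAt r r' t) (hθ : HasDerivAt θ θ' t) :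
    HasDerivAt (fun τ ↦ W (r τ) (θ τ)) (Wr (r t) (θ t) * r' + Wθ (r t) (θ t) * θ') t := by
  have hQd := hasDerivAt_Q_comp hr hθ
  have hS : HasDerivAt (fun τ ↦ sfl (Q (r τ) (θ τ)))
      (2 * r t * r' - 20 * (r' * sin (θ t) + r t * (cos (θ t) * θ'))) t := by
    have h := (hasDerivAt_sfl hQ).comp t hQd
    rw [one_mul] at h
    exact h
  have hs : HasDerivAt (fun τ ↦ sin (θ τ)) (cos (θ t) * θ') t := (hasDerivAt_sin (θ t)).comp t hθ
  have hN : HasDerivAt (fun τ ↦ 200 * (r τ * sin (θ τ) - 10))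
      (200 * (r' * sin (θ t) + r t * (cos (θ t) * θ'))) t := by
    have := ((hr.fun_mul hs).sub_const 10).const_mul 200
    simpa using this
  have hD := (hN.fun_div hS (sfl_ne_zero _)).const_add 10
  have hsfl : sfl (Q (r t) (θ t)) = Q (r t) (θ t) := sfl_of_ge hQ.le
  refine hD.congr_deriv ?_
  rw [hsfl, Wr, Wθ]
  have hQ0 : Q (r t) (θ t) ≠ 0 := by linarith
  exact derivW_aux (cos (θ t)) (sin (θ t)) (r t) r' θ' (Q (r t) (θ t)) rfl hQ0

/-- On the region, `(Ur, Wr) ≠ (0, 0)`: `Ur² + Wr² > 0` (the inversion is conformal away from its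
centre, the polar map is regular for `r > 0`). [folklore] -/
theorem Ur_sq_add_Wr_sq_pos {r θ : ℝ} (hr : 0 < r) (hs : sin θ ≤ 1 / 2) (hQ : 10 ≤ Q r θ) :
    0 < Ur r θ ^ 2 + Wr r θ ^ 2 := by
  have hQ0 : 0 < Q r θ := by linarith
  by_cases h10 : r = 10
  · subst h10
    have hW : 0 < Wr 10 θ := by
      rw [Wr]
      have : 0 < 20 * (10:ℝ) - (10 ^ 2 + 100) * sin θ := by nlinarith
      positivity
    positivity
  · by_cases hc : cos θ = 0
    · -- then `sin θ = -1`
      have hs1 : sin θ ^ 2 = 1 := by nlinarith [sin_sq_add_cos_sq θ]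
      have hsn : sin θ = -1 := by
        have : (sin θ - 1) * (sin θ + 1) = 0 := by nlinarith
        rcases mul_eq_zero.1 this with h | h
        · linarith
        · linarith
      have hW : 0 < Wr r θ := by
        rw [Wr, hsn]
        have : 0 < 20 * r - (r ^ 2 + 100) * (-1) := by nlinarith
        positivity
      positivity
    · have hU : Ur r θ ≠ 0 := by
        rw [Ur]
        have h1 : (100 : ℝ) - r ^ 2 ≠ 0 := by
          intro h
          have : (10 - r) * (10 + r) = 0 := by nlinarith
          rcases mul_eq_zero.1 this with h' | h'
          · exact h10 (by linarith)
          · linarith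
        have h2 : Q r θ ^ 2 ≠ 0 := by positivity
        exact div_ne_zero (mul_ne_zero (mul_ne_zero (by norm_num) hc) h1) h2
      positivity

/-! ### Recovering the polar point from its inverse -/

/-- `U² + (W - 10)² = 200²/Q`: the inversion inverts the squared distance to its centre. [folklore] -/
theorem U_sq_add_sq (r θ : ℝ) (hQ : 10 ≤ Q r θ) : U r θ ^ 2 + (W r θ - 10) ^ 2 = 200 ^ 2 / Q r θ := by
  have hQ0 : Q r θ ≠ 0 := by linarith
  rw [U_eq hQ, W, sfl_of_ge hQ, add_sub_cancel_left, div_pow, div_pow, ← add_div]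
  rw [div_eq_div_iff (pow_ne_zero 2 hQ0) hQ0, Q]
  linear_combination (200 ^ 2 * r ^ 2 * (r ^ 2 - 20 * r * sin θ + 100)) * sin_sq_add_cos_sq θ

/-- **Recovering `r cos θ`**: `r cos θ = 200 U/(U² + (W - 10)²)`. [folklore] -/
theorem mul_cos_eq {r θ : ℝ} (hQ : 10 ≤ Q r θ) :
    r * cos θ = 200 * U r θ / (U r θ ^ 2 + (W r θ - 10) ^ 2) := by
  have hQ0 : Q r θ ≠ 0 := by linarith
  rw [U_sq_add_sq r θ hQ, U_eq hQ]
  field_simp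

/-- **Recovering `r sin θ`**: `r sin θ = 10 + 200 (W - 10)/(U² + (W - 10)²)`. [folklore] -/
theorem mul_sin_eq {r θ : ℝ} (hQ : 10 ≤ Q r θ) :
    r * sin θ = 10 + 200 * (W r θ - 10) / (U r θ ^ 2 + (W r θ - 10) ^ 2) := by
  have hQ0 : Q r θ ≠ 0 := by linarith
  rw [U_sq_add_sq r θ hQ, W, sfl_of_ge hQ, add_sub_cancel_left]
  field_simp
  ring

/-- **The model is injective on the region**: equal inverted points come from equal polar points.
[folklore] -/
theorem polar_eq_of_eq {r θ r' θ' : ℝ} (hQ : 10 ≤ Q r θ) (hQ' : 10 ≤ Q r' θ')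
    (hU : U r θ = U r' θ') (hW : W r θ = W r' θ') :
    r * cos θ = r' * cos θ' ∧ r * sin θ = r' * sin θ' := by
  rw [mul_cos_eq hQ, mul_cos_eq hQ', mul_sin_eq hQ, mul_sin_eq hQ', hU, hW]
  exact ⟨rfl, rfl⟩

/-- Equal polar points with positive radii and angles less than `2π` apart are equal. [folklore] -/
theorem eq_of_polar_eq {r θ r' θ' : ℝ} (hr : 0 < r) (hr' : 0 < r') (hc : r * cos θ = r' * cos θ')
    (hs : r * sin θ = r' * sin θ') (hθ : |θ - θ'| < 2 * π) : r = r' ∧ θ = θ' := by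
  have hsq : r ^ 2 = r' ^ 2 := by
    have h1 : (r * cos θ) ^ 2 + (r * sin θ) ^ 2 = r ^ 2 := by nlinarith [sin_sq_add_cos_sq θ]
    have h2 : (r' * cos θ') ^ 2 + (r' * sin θ') ^ 2 = r' ^ 2 := by nlinarith [sin_sq_add_cos_sq θ']
    rw [← h1, ← h2, hc, hs]
  have hrr : r = r' := by
    have := abs_eq_abs.2 (Or.inl rfl : r ^ 2 = r ^ 2 ∨ _)
    nlinarith [sq_nonneg (r - r'), sq_nonneg (r + r')]
  subst hrr
  have hc' : cos θ = cos θ' := mul_left_cancel₀ hr.ne' hc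
  have hs' : sin θ = sin θ' := mul_left_cancel₀ hr.ne' hs
  have h1 : cos (θ - θ') = 1 := by
    rw [cos_sub, hc', hs']; nlinarith [sin_sq_add_cos_sq θ']
  obtain ⟨n, hn⟩ := (cos_eq_one_iff _).1 h1
  have hn0 : n = 0 := by
    have habs : |(n : ℝ)| * (2 * π) < 1 * (2 * π) := by
      rw [← abs_of_pos (by positivity : (0:ℝ) < 2 * π), ← abs_mul, hn, one_mul,
        abs_of_pos (by positivity : (0:ℝ) < 2 * π)]
      exact hθ
    have h2 : |(n : ℝ)| < 1 := lt_of_mul_lt_mul_right habs (by positivity)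
    have h3 : |(n : ℤ)| < 1 := by exact_mod_cast h2
    rw [abs_lt] at h3
    omega
  subst hn0
  refine ⟨rfl, ?_⟩
  simp at hn; linarith

end Polar

end BandSumUnit

end Literature.Topology.FourManifolds
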